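import Mathlib
import HarnessLib

/-!
# Sub-solutions of Dobrushin's linear system: comparison, exponentially weighted decay, and the
# two-scale (site → block) step (Presutti 2009, Thm. 3.2.4.1, Thm. 3.2.5.3 / Cor. 3.2.5.4,
# §11.5.3 (11.5.3.8)–(11.5.3.9), §11.5.6 (11.5.6.9)–(11.5.6.11))

[topic Probability/LatticeModels]

E. Presutti, *Scaling Limits in Statistical Mechanics and Microstructures in Continuum Mechanics*
(Springer TMP 2009) [Presutti2009], §3.2.4 «Equations for the first moments» and §3.2.5 «Decay
properties of the Green function». Dobrushin's coupling technique (Thm. 3.1.3.4, Thm. 3.2.2.1 /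
Cor. 3.2.2.2 — in the tree: `DobrushinCouplingConstruction.lean` for finite spins,
`TransportMaps/DobrushinCouplingCompact.lean` for compact spins) produces a vector
`vᵢ = E_Q d(ωᵢ, ω'ᵢ)` that is a SUB-SOLUTION (3.2.4.3) of the linear system (3.2.4.1)
`u = α + r u`. This file is the printed analysis of such sub-solutions on a FINITE index set —
pure real linear algebra, no measure theory (the measure-level consequences, Presutti's
Thm. 11.5.4.1 / Cor. 11.5.4.2, are `TransportMaps/DobrushinCouplingDecay.lean`):

* `sub_le_super` — **Theorem 3.2.4.1, last assertion** (p. 117: «if `v` is a sub-solution of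
  (3.2.4.1) … then `v ≤ u`»), in the form «sub-solution ≤ super-solution» under Dobrushin's row
  condition `Σ_{j ≠ i} r_{ij} ≤ ρ < 1` (3.1.3.4) (the printed `u` is THE solution
  `Σ_y g_Λ(x,y) α(y)` (3.2.4.4); any super-solution dominates it; the maximum principle used here
  avoids the Green function (3.2.4.5));
* `sub_le_weighted_sup` — **Corollary 3.2.5.4 with Theorem 3.2.5.3 (decay rate)** (p. 119:
  under the weighted condition `Σ_{j ≠ i} r_{ij} e^{δ(i,j)} ≤ r' < 1` (3.2.5.1) for a metric `δ`,
  `u(x) ≤ (1 − r')⁻¹ sup_y {e^{−δ(x,y)} α'(y)}`), here for every sub-solution and any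
  pseudo-metric `δ`; sum form `sub_le_weighted_sum`; «boundary» form `sub_le_weighted_boundary`
  (`α ≤ D Σ_{j ∈ B} e^{−δ(·,j)}` ⟹ `vᵢ ≤ D (1 − r')⁻¹ Σ_{j ∈ B} e^{−δ(i,j)}`, the shape of
  (11.5.4.2));
* `toReal_sub_of_lintegral_sub`, `lintegral_sub_le_weighted_sup` — the same for `ℝ≥0∞`-valued
  `v` with finite entries (the currency of the coupling files);
* `blockSup_sub`, `sub_le_weighted_twoScale` — **the two-scale step of §11.5.6** («We regard
  our system as a process `{ξᵢ, i ∈ I}` … `ξᵢ = σ_{Cᵢ}`», p. 388; (11.5.6.9)–(11.5.6.11) with the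
  coefficients (11.5.3.8)–(11.5.3.9)): for sites grouped into blocks, the BLOCK MAXIMA of a
  site-level sub-solution whose coefficients have in-block rows `≤ R₀(i) < 1` (Presutti's
  `r*(i) < 1`) and block-to-block rows `≤ R(i,j)` (his `r*(i,j)`) form a block-level sub-solution
  with Presutti's block coefficients `θ(i,j) = (1 − R₀(i))⁻¹ R(i,j)` (11.5.3.9), whence decay at
  the block scale under (11.5.4.1).

The unweighted special case «`v(i) ≤ (max C)/(1 − ρ)`» of the remark after Cor. 3.2.2.2 is
`DobrushinCoupling.le_sup_div_of_le_add_sum_mul` (finite file). Related but different devices in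
the tree: Föllmer's dusting iteration with profiles / Künsch–Georgii weights
(`DobrushinMetricWeightedDecay`, `DobrushinShlosmanWeighted`, `superSolution_geometric`) act on
Lipschitz estimates of two invariant states, not on the discrepancy vector of one coupling.
-- TODO(general form): countably many sites with summable rows (Presutti's `Λ` bounded ⇒ finite,
-- as here); the Green function `g_Λ` (3.2.4.5) itself and Thm. 3.2.5.1 / Cor. 3.2.5.5.

## References
* E. Presutti, *Scaling Limits in Statistical Mechanics and Microstructures in Continuum Mechanics*,
  Springer TMP 2009: §3.2.4 Thm. 3.2.4.1; §3.2.5 Thm. 3.2.5.3, Cor. 3.2.5.4; §11.5.3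
  (11.5.3.8)–(11.5.3.10); §11.5.4 (11.5.4.1); §11.5.6 (11.5.6.9)–(11.5.6.11). [Presutti2009]
* R. L. Dobrushin, Theory Probab. Appl. 15 (1970) 458–486.
-/

noncomputable section

open Finset
open scoped ENNReal NNReal

namespace Literature.Probability.LatticeModels

namespace DobrushinSubsolution

/-! ### §3.2.4–§3.2.5: sub-solutions of `v ≤ α + r v` on a finite index set -/

section Linear

variable {ι : Type*} [Fintype ι] [DecidableEq ι]

/-- **Presutti 2009, Theorem 3.2.4.1 (last assertion: «if `v` is a sub-solution … then `v ≤ u`»),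
finite index set `Λ = ι`, in super-solution form.** If `r ≥ 0` has Dobrushin rows
`Σ_{j ≠ i} r_{ij} ≤ ρ < 1` (3.1.3.4), `v` is a sub-solution (`vᵢ ≤ αᵢ + Σ_{j ≠ i} r_{ij} vⱼ`,
(3.2.4.3)) and `u` a super-solution (`αᵢ + Σ_{j ≠ i} r_{ij} uⱼ ≤ uᵢ`), then `v ≤ u`. (Printed for
THE solution `u = Σ g_Λ α` via the Green function (3.2.4.4)–(3.2.4.5); here by the maximum
principle: the excess `v − u` would satisfy `w ≤ r w`, impossible at a positive maximum.)
[cite: Presutti2009, §3.2.4 Thm. 3.2.4.1] -/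
theorem sub_le_super {r : ι → ι → ℝ} (hr : ∀ i j, 0 ≤ r i j) {ρ : ℝ} (hρ : ρ < 1)
    (hrow : ∀ i, ∑ j ∈ univ.erase i, r i j ≤ ρ) {α v u : ι → ℝ}
    (hv : ∀ i, v i ≤ α i + ∑ j ∈ univ.erase i, r i j * v j)
    (hu : ∀ i, α i + ∑ j ∈ univ.erase i, r i j * u j ≤ u i) (i : ι) : v i ≤ u i := by
  by_contra hlt
  push Not at hlt
  obtain ⟨i₀, -, hmax⟩ := exists_max_image univ (fun j => v j - u j) ⟨i, mem_univ i⟩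
  have hmax' : ∀ j, v j - u j ≤ v i₀ - u i₀ := fun j => hmax j (mem_univ j)
  have hpos : 0 < v i₀ - u i₀ := lt_of_lt_of_le (sub_pos.2 hlt) (hmax' i)
  have h1 : v i₀ - u i₀ ≤ ∑ j ∈ univ.erase i₀, r i₀ j * (v j - u j) := by
    have e : ∑ j ∈ univ.erase i₀, r i₀ j * (v j - u j) =
        ∑ j ∈ univ.erase i₀, r i₀ j * v j - ∑ j ∈ univ.erase i₀, r i₀ j * u j := by
      rw [← sum_sub_distrib]
      exact sum_congr rfl fun j _ => mul_sub _ _ _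
    rw [e]
    linarith [hv i₀, hu i₀]
  have h2 : ∑ j ∈ univ.erase i₀, r i₀ j * (v j - u j) ≤ ρ * (v i₀ - u i₀) :=
    calc ∑ j ∈ univ.erase i₀, r i₀ j * (v j - u j)
        ≤ ∑ j ∈ univ.erase i₀, r i₀ j * (v i₀ - u i₀) :=
          sum_le_sum fun j _ => mul_le_mul_of_nonneg_left (hmax' j) (hr i₀ j)
      _ = (∑ j ∈ univ.erase i₀, r i₀ j) * (v i₀ - u i₀) := by rw [sum_mul]
      _ ≤ ρ * (v i₀ - u i₀) := mul_le_mul_of_nonneg_right (hrow i₀) hpos.le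
  have h3 : ρ * (v i₀ - u i₀) < 1 * (v i₀ - u i₀) := mul_lt_mul_of_pos_right hρ hpos
  linarith

/-- Under the weighted row condition with a nonnegative weight exponent the plain Dobrushin rows
are also `≤ ρ` («Notice that (3.2.5.1) implies (3.1.3.4)»). [cite: Presutti2009, §3.2.5 (3.2.5.1)] -/
theorem row_le_of_weighted {r : ι → ι → ℝ} (hr : ∀ i j, 0 ≤ r i j) {δ : ι → ι → ℝ}
    (hδ : ∀ i j, 0 ≤ δ i j) {ρ : ℝ}
    (hrow : ∀ i, ∑ j ∈ univ.erase i, r i j * Real.exp (δ i j) ≤ ρ) (i : ι) :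
    ∑ j ∈ univ.erase i, r i j ≤ ρ :=
  (sum_le_sum fun j _ => le_mul_of_one_le_right (hr i j) (Real.one_le_exp (hδ i j))).trans
    (hrow i)

/-- **Presutti 2009, Corollary 3.2.5.4 with Theorem 3.2.5.3 (decay rate), finite index set, for
sub-solutions.** Let `δ` be a pseudo-metric on the sites (`δ(i,i) = 0`, `δ ≥ 0`, triangle
inequality) and suppose the WEIGHTED Dobrushin condition (3.2.5.1)
`Σ_{j ≠ i} r_{ij} e^{δ(i,j)} ≤ ρ < 1`. Then every sub-solution `v` of `v ≤ α + r v` with `α ≥ 0`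
satisfies `vᵢ ≤ (1 − ρ)⁻¹ · max_k e^{−δ(i,k)} α_k` («`u(x) ≤ (1 − r')⁻¹ sup_{y} {e^{−δ(x,y)} α'(y)}`»,
the case `ψ ≡ 0`). Proof: `W(i) = max_k e^{−δ(i,k)} α_k` dominates `α` and satisfies
`W(j) ≤ e^{δ(i,j)} W(i)` by the triangle inequality, so `(1 − ρ)⁻¹ W` is a super-solution;
`sub_le_super`. [cite: Presutti2009, §3.2.5 Thm. 3.2.5.3 and Cor. 3.2.5.4] -/
theorem sub_le_weighted_sup {r : ι → ι → ℝ} (hr : ∀ i j, 0 ≤ r i j) {δ : ι → ι → ℝ}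
    (hδ0 : ∀ i, δ i i = 0) (hδ : ∀ i j, 0 ≤ δ i j) (htri : ∀ i j k, δ i k ≤ δ i j + δ j k)
    {ρ : ℝ} (hρ : ρ < 1) (hrow : ∀ i, ∑ j ∈ univ.erase i, r i j * Real.exp (δ i j) ≤ ρ)
    {α v : ι → ℝ} (hα : ∀ i, 0 ≤ α i)
    (hv : ∀ i, v i ≤ α i + ∑ j ∈ univ.erase i, r i j * v j) (i : ι) :
    v i ≤ (1 - ρ)⁻¹ * univ.sup' ⟨i, mem_univ i⟩ (fun k => Real.exp (-δ i k) * α k) := by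
  have hne : (univ : Finset ι).Nonempty := ⟨i, mem_univ i⟩
  -- the `δ`-regularised datum
  set W : ι → ℝ := fun l => univ.sup' hne (fun k => Real.exp (-δ l k) * α k) with hW
  have hαW : ∀ l, α l ≤ W l := fun l => by
    have hl : Real.exp (-δ l l) * α l ≤ W l :=
      le_sup' (fun k => Real.exp (-δ l k) * α k) (mem_univ l)
    simpa [hδ0 l] using hl
  have hW0 : ∀ l, 0 ≤ W l := fun l => (hα l).trans (hαW l)
  have hWtri : ∀ l j, W j ≤ Real.exp (δ l j) * W l := fun l j => by
    refine sup'_le _ _ fun k _ => ?_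
    have hk : Real.exp (-δ l k) * α k ≤ W l := le_sup' (fun k => Real.exp (-δ l k) * α k) (mem_univ k)
    calc Real.exp (-δ j k) * α k
        ≤ (Real.exp (δ l j) * Real.exp (-δ l k)) * α k := by
          refine mul_le_mul_of_nonneg_right ?_ (hα k)
          rw [← Real.exp_add]
          exact Real.exp_le_exp.2 (by linarith [htri l j k])
      _ = Real.exp (δ l j) * (Real.exp (-δ l k) * α k) := by ring
      _ ≤ Real.exp (δ l j) * W l := mul_le_mul_of_nonneg_left hk (Real.exp_pos _).le
  have h1ρ : 0 < 1 - ρ := sub_pos.2 hρ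
  -- `(1 - ρ)⁻¹ W` is a super-solution
  have hsuper : ∀ l, α l + ∑ j ∈ univ.erase l, r l j * ((1 - ρ)⁻¹ * W j) ≤ (1 - ρ)⁻¹ * W l := by
    intro l
    have hs : ∑ j ∈ univ.erase l, r l j * ((1 - ρ)⁻¹ * W j) ≤ (1 - ρ)⁻¹ * (ρ * W l) :=
      calc ∑ j ∈ univ.erase l, r l j * ((1 - ρ)⁻¹ * W j)
          ≤ ∑ j ∈ univ.erase l, r l j * ((1 - ρ)⁻¹ * (Real.exp (δ l j) * W l)) :=
            sum_le_sum fun j _ => mul_le_mul_of_nonneg_left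
              (mul_le_mul_of_nonneg_left (hWtri l j) (inv_nonneg.2 h1ρ.le)) (hr l j)
        _ = (1 - ρ)⁻¹ * ((∑ j ∈ univ.erase l, r l j * Real.exp (δ l j)) * W l) := by
            rw [sum_mul, mul_sum]
            exact sum_congr rfl fun j _ => by ring
        _ ≤ (1 - ρ)⁻¹ * (ρ * W l) :=
            mul_le_mul_of_nonneg_left (mul_le_mul_of_nonneg_right (hrow l) (hW0 l))
              (inv_nonneg.2 h1ρ.le)
    have hfix : W l + (1 - ρ)⁻¹ * (ρ * W l) = (1 - ρ)⁻¹ * W l := by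
      field_simp
      ring
    linarith [hαW l]
  exact sub_le_super hr hρ (row_le_of_weighted hr hδ hrow) hv hsuper i

/-- Sum form of `sub_le_weighted_sup`: `vᵢ ≤ (1 − ρ)⁻¹ Σ_k e^{−δ(i,k)} α_k`.
[cite: Presutti2009, §3.2.5 Cor. 3.2.5.4] -/
theorem sub_le_weighted_sum {r : ι → ι → ℝ} (hr : ∀ i j, 0 ≤ r i j) {δ : ι → ι → ℝ}
    (hδ0 : ∀ i, δ i i = 0) (hδ : ∀ i j, 0 ≤ δ i j) (htri : ∀ i j k, δ i k ≤ δ i j + δ j k)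
    {ρ : ℝ} (hρ : ρ < 1) (hrow : ∀ i, ∑ j ∈ univ.erase i, r i j * Real.exp (δ i j) ≤ ρ)
    {α v : ι → ℝ} (hα : ∀ i, 0 ≤ α i)
    (hv : ∀ i, v i ≤ α i + ∑ j ∈ univ.erase i, r i j * v j) (i : ι) :
    v i ≤ (1 - ρ)⁻¹ * ∑ k, Real.exp (-δ i k) * α k := by
  refine (sub_le_weighted_sup hr hδ0 hδ htri hρ hrow hα hv i).trans
    (mul_le_mul_of_nonneg_left (sup'_le _ _ fun k _ => ?_) (inv_nonneg.2 (sub_pos.2 hρ).le))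
  exact single_le_sum (f := fun k => Real.exp (-δ i k) * α k)
    (fun k _ => mul_nonneg (Real.exp_pos _).le (hα k)) (mem_univ k)

/-- **The shape of (11.5.4.2).** If the datum is concentrated near a set `B` of «boundary» sites in
the sense `α_k ≤ D Σ_{j ∈ B} e^{−δ(k,j)}` for every `k` (e.g. `α` supported in `B` with `α ≤ D`, or
Presutti's `α(i) = 4c₀ℓ₀^d ε₃ Σ_{j ∈ I∖I₀} e^{−ω₃|i−j|} + c₀ℓ₀^d Σ_{j ∈ I∖I₀} θ(i,j)` with
`δ < ω₃`), then `vᵢ ≤ D (1 − ρ)⁻¹ Σ_{j ∈ B} e^{−δ(i,j)}` («`E_Q(d_{C_i}) ≤ c ℓ₀^d Σ_{j ∈ I∖I₀}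
e^{−δ|i−j|}`»). [cite: Presutti2009, §11.5.4 Thm. 11.5.4.1 (11.5.4.2) via §3.2.5 Thm. 3.2.5.3] -/
theorem sub_le_weighted_boundary {r : ι → ι → ℝ} (hr : ∀ i j, 0 ≤ r i j) {δ : ι → ι → ℝ}
    (hδ0 : ∀ i, δ i i = 0) (hδ : ∀ i j, 0 ≤ δ i j) (htri : ∀ i j k, δ i k ≤ δ i j + δ j k)
    {ρ : ℝ} (hρ : ρ < 1) (hrow : ∀ i, ∑ j ∈ univ.erase i, r i j * Real.exp (δ i j) ≤ ρ)
    {α v : ι → ℝ} (hα : ∀ i, 0 ≤ α i)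
    (hv : ∀ i, v i ≤ α i + ∑ j ∈ univ.erase i, r i j * v j) (B : Finset ι) {D : ℝ}
    (hD : 0 ≤ D) (hαB : ∀ k, α k ≤ D * ∑ j ∈ B, Real.exp (-δ k j)) (i : ι) :
    v i ≤ D / (1 - ρ) * ∑ j ∈ B, Real.exp (-δ i j) := by
  refine (sub_le_weighted_sup hr hδ0 hδ htri hρ hrow hα hv i).trans ?_
  rw [div_eq_mul_inv, mul_comm D, mul_assoc]
  refine mul_le_mul_of_nonneg_left (sup'_le _ _ fun k _ => ?_) (inv_nonneg.2 (sub_pos.2 hρ).le)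
  calc Real.exp (-δ i k) * α k
      ≤ Real.exp (-δ i k) * (D * ∑ j ∈ B, Real.exp (-δ k j)) :=
        mul_le_mul_of_nonneg_left (hαB k) (Real.exp_pos _).le
    _ = D * ∑ j ∈ B, Real.exp (-δ i k) * Real.exp (-δ k j) := by rw [mul_left_comm, mul_sum]
    _ ≤ D * ∑ j ∈ B, Real.exp (-δ i j) := by
        refine mul_le_mul_of_nonneg_left (sum_le_sum fun j _ => ?_) hD
        rw [← Real.exp_add]
        exact Real.exp_le_exp.2 (by linarith [htri i k j])

/-- Passage to real numbers: an `ℝ≥0∞`-valued sub-solution with finite entries is a real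
sub-solution after `toReal`. [cite: Presutti2009, §3.2.4 (3.2.4.3)] -/
theorem toReal_sub_of_lintegral_sub {r : ι → ι → ℝ≥0} {c : ι → ℝ≥0} {v : ι → ℝ≥0∞}
    (hfin : ∀ i, v i ≠ ∞) (hv : ∀ i, v i ≤ c i + ∑ j ∈ univ.erase i, (r i j : ℝ≥0∞) * v j)
    (i : ι) : (v i).toReal ≤ (c i : ℝ) + ∑ j ∈ univ.erase i, (r i j : ℝ) * (v j).toReal := by
  have hsum_fin : ∑ j ∈ univ.erase i, (r i j : ℝ≥0∞) * v j ≠ ∞ :=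
    ENNReal.sum_ne_top.2 fun j _ => ENNReal.mul_ne_top ENNReal.coe_ne_top (hfin j)
  have h := ENNReal.toReal_mono (ENNReal.add_ne_top.2 ⟨ENNReal.coe_ne_top, hsum_fin⟩) (hv i)
  rw [ENNReal.toReal_add ENNReal.coe_ne_top hsum_fin, ENNReal.coe_toReal,
    ENNReal.toReal_sum (fun j _ => ENNReal.mul_ne_top ENNReal.coe_ne_top (hfin j))] at h
  simpa only [ENNReal.toReal_mul, ENNReal.coe_toReal] using h

/-- `sub_le_weighted_sup` in the `ℝ≥0∞` currency of `DobrushinCouplingCompact`: finite entries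
`vᵢ < ∞` with `vᵢ ≤ cᵢ + Σ_{j ≠ i} r_{ij} vⱼ` and the weighted condition give
`vᵢ ≤ ENNReal.ofReal ((1 − ρ)⁻¹ max_k e^{−δ(i,k)} c_k)`.
[cite: Presutti2009, §3.2.5 Cor. 3.2.5.4] -/
theorem lintegral_sub_le_weighted_sup {r : ι → ι → ℝ≥0} {c : ι → ℝ≥0} {δ : ι → ι → ℝ}
    (hδ0 : ∀ i, δ i i = 0) (hδ : ∀ i j, 0 ≤ δ i j) (htri : ∀ i j k, δ i k ≤ δ i j + δ j k)
    {ρ : ℝ} (hρ : ρ < 1) (hrow : ∀ i, ∑ j ∈ univ.erase i, (r i j : ℝ) * Real.exp (δ i j) ≤ ρ)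
    {v : ι → ℝ≥0∞} (hfin : ∀ i, v i ≠ ∞)
    (hv : ∀ i, v i ≤ c i + ∑ j ∈ univ.erase i, (r i j : ℝ≥0∞) * v j) (i : ι) :
    v i ≤ ENNReal.ofReal
      ((1 - ρ)⁻¹ * univ.sup' ⟨i, mem_univ i⟩ (fun k => Real.exp (-δ i k) * (c k : ℝ))) := by
  have hreal := sub_le_weighted_sup (fun l j => (r l j).coe_nonneg) hδ0 hδ htri hρ hrow
    (fun l => (c l).coe_nonneg) (toReal_sub_of_lintegral_sub hfin hv) i
  calc v i = ENNReal.ofReal ((v i).toReal) := (ENNReal.ofReal_toReal (hfin i)).symm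
    _ ≤ _ := ENNReal.ofReal_le_ofReal hreal

end Linear

/-! ### The two-scale step: block maxima of a site-level sub-solution form a block-level
sub-solution ((11.5.3.8)–(11.5.3.9), (11.5.6.9)–(11.5.6.11)) -/

section TwoScale

variable {X : Type*} [Fintype X] [DecidableEq X] {ι : Type*} [Fintype ι] [DecidableEq ι]

omit [DecidableEq X] [Fintype ι] in
/-- Blocks of a surjective block map are nonempty. [cite: Presutti2009, §11.5.3 (11.5.3.2)] -/
theorem block_nonempty (b : X → ι) (hb : Function.Surjective b) (j : ι) :
    (univ.filter fun x => b x = j).Nonempty :=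
  (hb j).imp fun x hx => mem_filter.2 ⟨mem_univ x, hx⟩

/-- **The two-scale linear step of §11.5.6** («We regard our system as a process
`{ξᵢ, i ∈ I}` … `ξᵢ = σ_{Cᵢ}`», p. 388; (11.5.6.9)–(11.5.6.11) with the coefficients (11.5.3.8)):
let the sites `X` be grouped into nonempty blocks by `b : X → ι`, and let `v ≥ 0` be a SITE-level
sub-solution `v(x) ≤ α(x) + Σ_{y ≠ x} r(x,y) v(y)` whose coefficients have in-block rows
`Σ_{y ∈ C_{b x} ∖ x} r(x,y) ≤ R₀(b x) < 1` (Presutti's `r*(i) < 1`) and block-to-block rows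
`Σ_{y ∈ C_j} r(x,y) ≤ R(b x, j)` (`j ≠ b x`; Presutti bounds this by `r*(i,j) = |C| max r(x,y)`),
with `α ≤ A(b x)`. Then the BLOCK MAXIMA `M(i) = max_{x ∈ C_i} v(x)` form a block-level
sub-solution with Presutti's coefficients (11.5.3.9):
`M(i) ≤ (1 − R₀(i))⁻¹ A(i) + Σ_{j ≠ i} (1 − R₀(i))⁻¹ R(i,j) M(j)`.
[cite: Presutti2009, §11.5.6 (11.5.6.9)–(11.5.6.11) with §11.5.3 (11.5.3.8)–(11.5.3.9)] -/
theorem blockSup_sub (b : X → ι) (hb : Function.Surjective b) {r : X → X → ℝ}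
    (hr : ∀ x y, 0 ≤ r x y) {R₀ : ι → ℝ} (hR₀ : ∀ i, R₀ i < 1) {R : ι → ι → ℝ}
    (hin : ∀ x, ∑ y ∈ (univ.erase x).filter (fun y => b y = b x), r x y ≤ R₀ (b x))
    (hout : ∀ x j, j ≠ b x → ∑ y ∈ (univ.erase x).filter (fun y => b y = j), r x y ≤ R (b x) j)
    {α v : X → ℝ} (hv0 : ∀ x, 0 ≤ v x)
    (hv : ∀ x, v x ≤ α x + ∑ y ∈ univ.erase x, r x y * v y) {A : ι → ℝ}
    (hA : ∀ x, α x ≤ A (b x)) (i : ι) :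
    (univ.filter fun x => b x = i).sup' (block_nonempty b hb i) v ≤
      (1 - R₀ i)⁻¹ * A i + ∑ j ∈ univ.erase i, ((1 - R₀ i)⁻¹ * R i j) *
        (univ.filter fun x => b x = j).sup' (block_nonempty b hb j) v := by
  set M : ι → ℝ := fun j => (univ.filter fun x => b x = j).sup' (block_nonempty b hb j) v with hM
  -- a maximiser in block `i`, and the basic properties of the block maxima
  obtain ⟨x₀, hx₀C, hx₀max⟩ := exists_mem_eq_sup' (block_nonempty b hb i) v
  have hbx₀ : b x₀ = i := (mem_filter.1 hx₀C).2
  have hMi : M i = v x₀ := hx₀max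
  have hvM : ∀ y, v y ≤ M (b y) := fun y =>
    le_sup' (s := univ.filter fun x => b x = b y) v (mem_filter.2 ⟨mem_univ y, rfl⟩)
  have hM0 : ∀ j, 0 ≤ M j := fun j => by
    obtain ⟨y, -, hyeq⟩ := exists_mem_eq_sup' (block_nonempty b hb j) v
    exact (hv0 y).trans_eq (hyeq.symm.trans rfl)
  have hvM' : ∀ j, ∀ y ∈ (univ.erase x₀).filter (fun y => b y = j), v y ≤ M j := fun j y hy => by
    have h := hvM y
    rwa [(mem_filter.1 hy).2] at h
  -- the in-block part of the site sum
  have hin' : ∑ y ∈ (univ.erase x₀).filter (fun y => b y = i), r x₀ y * v y ≤ R₀ i * M i :=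
    calc ∑ y ∈ (univ.erase x₀).filter (fun y => b y = i), r x₀ y * v y
        ≤ ∑ y ∈ (univ.erase x₀).filter (fun y => b y = i), r x₀ y * M i :=
          sum_le_sum fun y hy => mul_le_mul_of_nonneg_left (hvM' i y hy) (hr x₀ y)
      _ = (∑ y ∈ (univ.erase x₀).filter (fun y => b y = i), r x₀ y) * M i := by rw [sum_mul]
      _ ≤ R₀ i * M i := by
          refine mul_le_mul_of_nonneg_right ?_ (hM0 i)
          have h := hin x₀
          rwa [hbx₀] at h
  -- the block-to-block parts
  have hout' : ∀ j ∈ univ.erase i,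
      ∑ y ∈ (univ.erase x₀).filter (fun y => b y = j), r x₀ y * v y ≤ R i j * M j := by
    intro j hj
    have hji : j ≠ b x₀ := by rw [hbx₀]; exact ne_of_mem_erase hj
    calc ∑ y ∈ (univ.erase x₀).filter (fun y => b y = j), r x₀ y * v y
        ≤ ∑ y ∈ (univ.erase x₀).filter (fun y => b y = j), r x₀ y * M j :=
          sum_le_sum fun y hy => mul_le_mul_of_nonneg_left (hvM' j y hy) (hr x₀ y)
      _ = (∑ y ∈ (univ.erase x₀).filter (fun y => b y = j), r x₀ y) * M j := by rw [sum_mul]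
      _ ≤ R i j * M j := by
          refine mul_le_mul_of_nonneg_right ?_ (hM0 j)
          have h := hout x₀ j hji
          rwa [hbx₀] at h
  -- the site inequality at the maximiser, split over blocks
  have hsplit : ∑ y ∈ univ.erase x₀, r x₀ y * v y =
      ∑ j, ∑ y ∈ (univ.erase x₀).filter (fun y => b y = j), r x₀ y * v y :=
    (sum_fiberwise (univ.erase x₀) b fun y => r x₀ y * v y).symm
  have hkey : M i ≤ A i + (R₀ i * M i + ∑ j ∈ univ.erase i, R i j * M j) :=
    calc M i = v x₀ := hMi
      _ ≤ α x₀ + ∑ y ∈ univ.erase x₀, r x₀ y * v y := hv x₀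
      _ = α x₀ + (∑ y ∈ (univ.erase x₀).filter (fun y => b y = i), r x₀ y * v y +
            ∑ j ∈ univ.erase i, ∑ y ∈ (univ.erase x₀).filter (fun y => b y = j),
              r x₀ y * v y) := by
          rw [hsplit, ← add_sum_erase univ _ (mem_univ i)]
      _ ≤ A i + (R₀ i * M i + ∑ j ∈ univ.erase i, R i j * M j) :=
          add_le_add ((hA x₀).trans_eq (by rw [hbx₀])) (add_le_add hin' (sum_le_sum hout'))
  -- solve for `M i`
  have h1 : 0 < 1 - R₀ i := sub_pos.2 (hR₀ i)
  have hsum_eq : ∑ j ∈ univ.erase i, ((1 - R₀ i)⁻¹ * R i j) * M j =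
      (1 - R₀ i)⁻¹ * ∑ j ∈ univ.erase i, R i j * M j := by
    rw [mul_sum]
    exact sum_congr rfl fun j _ => by ring
  rw [hsum_eq, ← mul_add, le_inv_mul_iff₀ h1]
  have e : (1 - R₀ i) * M i = M i - R₀ i * M i := by ring
  rw [e]
  linarith

/-- **Decay from site-level data through the two-scale step** (Presutti's route
(11.5.6.9)–(11.5.6.11) ⟶ «Conclusions» ⟶ Thm. 3.2.5.3): under the hypotheses of
`blockSup_sub` with `A ≥ 0`, `R ≥ 0`, and the weighted block condition (11.5.4.1)
`Σ_{j ≠ i} θ(i,j) e^{δ(i,j)} ≤ ρ < 1` for `θ(i,j) = (1 − R₀(i))⁻¹ R(i,j)` and a pseudo-metric `δ`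
on the blocks, every site satisfies
`v(x) ≤ (1 − ρ)⁻¹ max_k e^{−δ(b x, k)} (1 − R₀(k))⁻¹ A(k)`.
[cite: Presutti2009, §11.5.4 Thm. 11.5.4.1 via §11.5.6 (11.5.6.9)–(11.5.6.11) and §3.2.5 Thm. 3.2.5.3] -/
theorem sub_le_weighted_twoScale (b : X → ι) (hb : Function.Surjective b) {r : X → X → ℝ}
    (hr : ∀ x y, 0 ≤ r x y) {R₀ : ι → ℝ} (hR₀ : ∀ i, R₀ i < 1) {R : ι → ι → ℝ}
    (hR : ∀ i j, 0 ≤ R i j)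
    (hin : ∀ x, ∑ y ∈ (univ.erase x).filter (fun y => b y = b x), r x y ≤ R₀ (b x))
    (hout : ∀ x j, j ≠ b x → ∑ y ∈ (univ.erase x).filter (fun y => b y = j), r x y ≤ R (b x) j)
    {α v : X → ℝ} (hv0 : ∀ x, 0 ≤ v x)
    (hv : ∀ x, v x ≤ α x + ∑ y ∈ univ.erase x, r x y * v y) {A : ι → ℝ} (hA0 : ∀ i, 0 ≤ A i)
    (hA : ∀ x, α x ≤ A (b x)) {δ : ι → ι → ℝ} (hδ0 : ∀ i, δ i i = 0) (hδ : ∀ i j, 0 ≤ δ i j)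
    (htri : ∀ i j k, δ i k ≤ δ i j + δ j k) {ρ : ℝ} (hρ : ρ < 1)
    (hrowB : ∀ i, ∑ j ∈ univ.erase i, ((1 - R₀ i)⁻¹ * R i j) * Real.exp (δ i j) ≤ ρ) (x : X) :
    v x ≤ (1 - ρ)⁻¹ * univ.sup' ⟨b x, mem_univ _⟩
      (fun k => Real.exp (-δ (b x) k) * ((1 - R₀ k)⁻¹ * A k)) := by
  have hθ : ∀ i j, 0 ≤ (1 - R₀ i)⁻¹ * R i j :=
    fun i j => mul_nonneg (inv_nonneg.2 (sub_pos.2 (hR₀ i)).le) (hR i j)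
  have hαB : ∀ k, 0 ≤ (1 - R₀ k)⁻¹ * A k :=
    fun k => mul_nonneg (inv_nonneg.2 (sub_pos.2 (hR₀ k)).le) (hA0 k)
  have hM := blockSup_sub b hb hr hR₀ hin hout hv0 hv hA
  have hdecay := sub_le_weighted_sup hθ hδ0 hδ htri hρ hrowB hαB hM (b x)
  exact (le_sup' (s := univ.filter fun y => b y = b x) v (mem_filter.2 ⟨mem_univ x, rfl⟩)).trans
    hdecay

end TwoScale

end DobrushinSubsolution

end Literature.Probability.LatticeModels

end
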